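import Literature.AlgebraicGeometry.Motives.HodgeStructureDivisorClassesFunctoriality
import Literature.AlgebraicGeometry.Motives.HodgeStructurePicardNumberDirectSum
import HarnessLib

/-!
# The Hodge classes of `⋀ᵏ(H₁ ⊕ H₂)` split off `⋀ᵏ H₁` and `⋀ᵏ H₂`: exterior pull-backs `⋀(in₁) B(H₁) ⊕ ⋀(in₂) B(H₂) ⊕ (mixed)`,
# and in degree two the mixed divisor classes have dimension `dim_ℚ Hom_HS(H₁, H₂)` (Hulek–Laface Prop. 2.2 / Cor. 2.3,
# "`NS(A × B) = p₁^*NS(A) ⊕ p₂^*NS(B) ⊕ Hom(A, B)`", on the abstract carrier)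

[topic AlgebraicGeometry/Motives]

Layer `Literature/AlgebraicGeometry/Motives`, lane `lit-hodgefound` (Track 2 foundations library; prover seat `lit-hodgefound-p34`,
generation 26, row g26-#7). THEOREMS ONLY (no `def`, no named fact, net debt `0`). Sequel of the seat's g26-#6
`Motives/HodgeStructureDivisorClassesFunctoriality` (`⋀ᵏ f` maps Hodge classes to Hodge classes and `Dᵖ` into `Dᵖ`; retraction
pairs `pr ∘ in = id`) and g26-#5 `Motives/HodgeStructurePicardNumberDirectSum` (`ρ(H₁ ⊕ H₂) = ρ(H₁) + ρ(H₂) + dim_ℚ Hom_HS(H₁, H₂)`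
for polarized structures of odd weight).

## The sources, verbatim

K. Hulek, R. Laface, *On the Picard numbers of abelian varieties* (2019) [HulekLaface2019PicardNumbersAV] (held text
`paper:arxiv-1703.05882`, chunk p0005): "**Proposition 2.2.** Let `A₁, …, A_r` be simple abelian varieties, such that `A_i` is
not isogenous to `A_j` for `i ≠ j`. Then the (exterior) pullback of line bundles yields an isomorphism
`∏ Pic(A_i^{n_i}) ≅ Pic(∏ A_i^{n_i})`. Clearly, exterior pull-back of line bundles always yields an injective map, but
surjectivity is a special feature. In fact, if `E` is an elliptic curve, the abelian surface `E × E` has Picard number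
`ρ ∈ {3, 4}`, depending on the presence of CM. Therefore, the exterior pull-back map `Pic(E) × Pic(E) → Pic(E × E)` cannot be
surjective"; proof: "`Hom(A_i, A_j) = Hom(A_i, A_j^∨) = 0` […] `ψ^{NS}` is an isomorphism"; "**Corollary 2.3.** […] the Picard
number is additive". H. Lange, *Abelian Varieties over the Complex Numbers* (2023) [Lange2023AbelianVarietiesComplex], §2.4.2
Prop. 2.4.12 (a) (chunk p0118; `NS_ℚ = End^s`, whence `ρ(X₁ × X₂) = ρ(X₁) + ρ(X₂) + rank Hom(X₁, X₂)`). C. Voisin, *Hodge Theory and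
Complex Algebraic Geometry I* (2002), §11.3.3 Thm. 11.38 / 11.40 (the Künneth components of a Hodge class are Hodge classes).

## Reading on the carrier, and what is PROVED

`H₁ ⊕ H₂ = H₁.prod H₂` on `V × W` (for abelian varieties `Hᵢ = H¹(Aᵢ, ℚ)`, `H¹(A₁ × A₂) = H₁ ⊕ H₂`, `Hᵏ(A₁ × A₂) = ⋀ᵏ(H₁ ⊕ H₂)`,
`p_i^* = ⋀ᵏ(in_i)` on `Hᵏ`, restriction to the factor `A_i ↪ A₁ × A₂` is `⋀ᵏ(pr_i)`); `Bᵏ_p(H) = Hdgᵖ(⋀ᵏ H)`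
(`(H.exteriorPower k).hodgeClasses p`), `B¹ = Hdgⁿ(⋀² H) = D¹` the divisor classes; `⋀ᵏ = exteriorPower.map k`.

* §1 MODULE LEVEL (any commutative ring, `k ≠ 0`): `⋀ᵏ 0 = 0`; `⋀ᵏ pr₁ ∘ ⋀ᵏ in₁ = id`, `⋀ᵏ pr₁ ∘ ⋀ᵏ in₂ = 0` (and `1 ↔ 2`); the MIXED PART
  `x₀ = x − ⋀ᵏ in₁ ⋀ᵏ pr₁ x − ⋀ᵏ in₂ ⋀ᵏ pr₂ x` is killed by `⋀ᵏ pr₁` and `⋀ᵏ pr₂`; uniqueness of a decomposition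
  `x = ⋀ᵏ in₁ y₁ + ⋀ᵏ in₂ y₂ + y₀` with `y₀` mixed (`y₁ = ⋀ᵏ pr₁ x`, `y₂ = ⋀ᵏ pr₂ x`).
* §2 HODGE CLASSES (any weight, `k ≠ 0`, level `p`): the three parts of a Hodge class of `⋀ᵏ(H₁ ⊕ H₂)` are Hodge classes;
  **`Bᵏ_p(H₁ ⊕ H₂) = ⋀ᵏin₁ Bᵏ_p(H₁) ⊔ ⋀ᵏin₂ Bᵏ_p(H₂) ⊔ Bᵏ_p(H₁ ⊕ H₂)_{mixed}`** with `_{mixed} = Bᵏ_p ⊓ ker ⋀ᵏpr₁ ⊓ ker ⋀ᵏpr₂`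
  (`hodgeClasses_exteriorPower_prod_eq_sup`), the decomposition is unique ("exterior pull-back […] always yields an injective
  map": `disjoint_map_inl_map_inr_hodgeClasses`, `disjoint_sup_map_hodgeClasses_mixed`), and **`dim Bᵏ_p(H₁ ⊕ H₂) = dim Bᵏ_p(H₁) +
  dim Bᵏ_p(H₂) + dim Bᵏ_p(H₁ ⊕ H₂)_{mixed}`** (`finrank_hodgeClasses_exteriorPower_prod_eq`; `⋀ᵏin₁`, `⋀ᵏin₂` are injective).
* §3 DEGREE TWO, ODD WEIGHT, `H₁`, `H₂` POLARIZED: **`dim B¹(H₁ ⊕ H₂)_{mixed} = dim_ℚ Hom_HS(H₁, H₂)`**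
  (`Polarization.finrank_hodgeClasses_two_prod_mixed_eq`, from §2 and g26-#5) — the carrier form of "`NS(A₁ × A₂) = p₁^*NS(A₁) ⊕
  p₂^*NS(A₂) ⊕ Hom(A₁, A₂)`"; hence **`Hom_HS(H₁, H₂) = 0 ⟹` no mixed divisor classes and `B¹(H₁ ⊕ H₂) = ⋀²in₁ B¹(H₁) ⊔ ⋀²in₂ B¹(H₂)`**
  ("`ψ^{NS}` is an isomorphism", Prop. 2.2), and conversely **`Hom_HS(H₁, H₂) ≠ 0 ⟹` a mixed divisor class exists** ("surjectivity is
  a special feature […] `E × E`").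

NOT here: the identification of the mixed part with p02's Künneth summand `⋀¹H₁ ⊗ ⋀¹H₂` of `Motives/HodgeStructureExteriorPowerDirectSum`
(by name), an explicit isomorphism `B¹_{mixed} ≅ Hom_HS(H₁, H₂)` (only the dimension count), even weight in §3.

## References

* [HulekLaface2019PicardNumbersAV] K. Hulek, R. Laface, *On the Picard numbers of abelian varieties*, Ann. Sc. Norm. Super. Pisa
  (2019), §2.1 Prop. 2.2, Cor. 2.3.
* [Lange2023AbelianVarietiesComplex] H. Lange, *Abelian Varieties over the Complex Numbers*, Springer (2023), §2.4.2 Prop. 2.4.12.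
* [VoisinHodgeI2002] C. Voisin, *Hodge Theory and Complex Algebraic Geometry I* (2002), §11.3.3 Thm. 11.38, Thm. 11.40; §7.3.1.
* [BourbakiAlgebre1a3] N. Bourbaki, *Algèbre*, Ch. III §7 no. 2 Prop. 2 (functoriality of `⋀ᵏ`), no. 7 Prop. 10.
-/

noncomputable section

open scoped TensorProduct

namespace Literature.AlgebraicGeometry.Motives

namespace HodgeStructure

universe u v

/-! ## §1 Module level: `⋀ᵏ` of the projections and injections of `M × N` -/

section ModuleLevel

variable {R : Type*} [CommRing R] {M : Type*} [AddCommGroup M] [Module R M] {N : Type*} [AddCommGroup N] [Module R N]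

/-- `⋀ᵏ 0 = 0` for `k ≠ 0` (a wedge with a zero factor vanishes). [cite: BourbakiAlgebre1a3, Ch. III §7 no. 2 Prop. 2] -/
theorem exteriorPower_map_zero_of_ne_zero {k : ℕ} (hk : k ≠ 0) : _root_.exteriorPower.map k (0 : M →ₗ[R] N) = 0 := by
  refine LinearMap.ext_on_range (exteriorPower.ιMulti_span R k M) fun m ↦ ?_
  rw [LinearMap.zero_apply, exteriorPower.map_apply_ιMulti]
  exact AlternatingMap.map_coord_zero (exteriorPower.ιMulti R k) (m := (0 : M →ₗ[R] N) ∘ m) ⟨0, Nat.pos_of_ne_zero hk⟩ rfl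

/-- `⋀ᵏ pr₁ ∘ ⋀ᵏ in₁ = id`. [cite: BourbakiAlgebre1a3, Ch. III §7 no. 2 Prop. 2] -/
theorem exteriorPower_map_fst_comp_map_inl (k : ℕ) :
    _root_.exteriorPower.map k (LinearMap.fst R M N) ∘ₗ _root_.exteriorPower.map k (LinearMap.inl R M N) = LinearMap.id := by
  rw [← _root_.exteriorPower.map_comp, LinearMap.fst_comp_inl, _root_.exteriorPower.map_id]

/-- `⋀ᵏ pr₂ ∘ ⋀ᵏ in₂ = id`. [cite: BourbakiAlgebre1a3, Ch. III §7 no. 2 Prop. 2] -/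
theorem exteriorPower_map_snd_comp_map_inr (k : ℕ) :
    _root_.exteriorPower.map k (LinearMap.snd R M N) ∘ₗ _root_.exteriorPower.map k (LinearMap.inr R M N) = LinearMap.id := by
  rw [← _root_.exteriorPower.map_comp, LinearMap.snd_comp_inr, _root_.exteriorPower.map_id]

/-- `⋀ᵏ pr₁ ∘ ⋀ᵏ in₂ = 0` for `k ≠ 0`. [cite: BourbakiAlgebre1a3, Ch. III §7 no. 2 Prop. 2] -/
theorem exteriorPower_map_fst_comp_map_inr {k : ℕ} (hk : k ≠ 0) :
    _root_.exteriorPower.map k (LinearMap.fst R M N) ∘ₗ _root_.exteriorPower.map k (LinearMap.inr R M N) = 0 := by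
  rw [← _root_.exteriorPower.map_comp, LinearMap.fst_comp_inr, exteriorPower_map_zero_of_ne_zero hk]

/-- `⋀ᵏ pr₂ ∘ ⋀ᵏ in₁ = 0` for `k ≠ 0`. [cite: BourbakiAlgebre1a3, Ch. III §7 no. 2 Prop. 2] -/
theorem exteriorPower_map_snd_comp_map_inl {k : ℕ} (hk : k ≠ 0) :
    _root_.exteriorPower.map k (LinearMap.snd R M N) ∘ₗ _root_.exteriorPower.map k (LinearMap.inl R M N) = 0 := by
  rw [← _root_.exteriorPower.map_comp, LinearMap.snd_comp_inl, exteriorPower_map_zero_of_ne_zero hk]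

/-- `⋀ᵏ pr₁ (⋀ᵏ in₁ y₁ + ⋀ᵏ in₂ y₂) = y₁` (`k ≠ 0`). [cite: BourbakiAlgebre1a3, Ch. III §7 no. 2 Prop. 2] -/
theorem exteriorPower_map_fst_add {k : ℕ} (hk : k ≠ 0) (y₁ : ⋀[R]^k M) (y₂ : ⋀[R]^k N) :
    _root_.exteriorPower.map k (LinearMap.fst R M N)
        (_root_.exteriorPower.map k (LinearMap.inl R M N) y₁ + _root_.exteriorPower.map k (LinearMap.inr R M N) y₂) = y₁ := by
  rw [map_add, ← LinearMap.comp_apply, exteriorPower_map_fst_comp_map_inl, LinearMap.id_apply, ← LinearMap.comp_apply,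
    exteriorPower_map_fst_comp_map_inr hk, LinearMap.zero_apply, add_zero]

/-- `⋀ᵏ pr₂ (⋀ᵏ in₁ y₁ + ⋀ᵏ in₂ y₂) = y₂` (`k ≠ 0`). [cite: BourbakiAlgebre1a3, Ch. III §7 no. 2 Prop. 2] -/
theorem exteriorPower_map_snd_add {k : ℕ} (hk : k ≠ 0) (y₁ : ⋀[R]^k M) (y₂ : ⋀[R]^k N) :
    _root_.exteriorPower.map k (LinearMap.snd R M N)
        (_root_.exteriorPower.map k (LinearMap.inl R M N) y₁ + _root_.exteriorPower.map k (LinearMap.inr R M N) y₂) = y₂ := by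
  rw [map_add, ← LinearMap.comp_apply, exteriorPower_map_snd_comp_map_inl hk, LinearMap.zero_apply, zero_add,
    ← LinearMap.comp_apply, exteriorPower_map_snd_comp_map_inr, LinearMap.id_apply]

/-- **The mixed part of a `k`-vector of `M × N` (`k ≠ 0`)**: `x₀ = x − ⋀ᵏin₁ ⋀ᵏpr₁ x − ⋀ᵏin₂ ⋀ᵏpr₂ x` is killed by `⋀ᵏ pr₁`.
[cite: BourbakiAlgebre1a3, Ch. III §7 no. 7 Prop. 10] -/
theorem exteriorPower_map_fst_mixedPart {k : ℕ} (hk : k ≠ 0) (x : ⋀[R]^k (M × N)) :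
    _root_.exteriorPower.map k (LinearMap.fst R M N)
        (x - _root_.exteriorPower.map k (LinearMap.inl R M N) (_root_.exteriorPower.map k (LinearMap.fst R M N) x) -
          _root_.exteriorPower.map k (LinearMap.inr R M N) (_root_.exteriorPower.map k (LinearMap.snd R M N) x)) = 0 := by
  have h1 : _root_.exteriorPower.map k (LinearMap.fst R M N)
      (_root_.exteriorPower.map k (LinearMap.inl R M N) (_root_.exteriorPower.map k (LinearMap.fst R M N) x)) =
        _root_.exteriorPower.map k (LinearMap.fst R M N) x := by
    rw [← LinearMap.comp_apply, exteriorPower_map_fst_comp_map_inl, LinearMap.id_apply]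
  have h2 : _root_.exteriorPower.map k (LinearMap.fst R M N)
      (_root_.exteriorPower.map k (LinearMap.inr R M N) (_root_.exteriorPower.map k (LinearMap.snd R M N) x)) = 0 := by
    rw [← LinearMap.comp_apply, exteriorPower_map_fst_comp_map_inr hk, LinearMap.zero_apply]
  rw [map_sub, map_sub, h1, h2, sub_self, sub_zero]

/-- **The mixed part is killed by `⋀ᵏ pr₂`.** [cite: BourbakiAlgebre1a3, Ch. III §7 no. 7 Prop. 10] -/
theorem exteriorPower_map_snd_mixedPart {k : ℕ} (hk : k ≠ 0) (x : ⋀[R]^k (M × N)) :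
    _root_.exteriorPower.map k (LinearMap.snd R M N)
        (x - _root_.exteriorPower.map k (LinearMap.inl R M N) (_root_.exteriorPower.map k (LinearMap.fst R M N) x) -
          _root_.exteriorPower.map k (LinearMap.inr R M N) (_root_.exteriorPower.map k (LinearMap.snd R M N) x)) = 0 := by
  have h1 : _root_.exteriorPower.map k (LinearMap.snd R M N)
      (_root_.exteriorPower.map k (LinearMap.inl R M N) (_root_.exteriorPower.map k (LinearMap.fst R M N) x)) = 0 := by
    rw [← LinearMap.comp_apply, exteriorPower_map_snd_comp_map_inl hk, LinearMap.zero_apply]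
  have h2 : _root_.exteriorPower.map k (LinearMap.snd R M N)
      (_root_.exteriorPower.map k (LinearMap.inr R M N) (_root_.exteriorPower.map k (LinearMap.snd R M N) x)) =
        _root_.exteriorPower.map k (LinearMap.snd R M N) x := by
    rw [← LinearMap.comp_apply, exteriorPower_map_snd_comp_map_inr, LinearMap.id_apply]
  rw [map_sub, map_sub, h1, h2, sub_zero, sub_self]

/-- **Uniqueness of the decomposition `x = ⋀ᵏin₁ y₁ + ⋀ᵏin₂ y₂ + y₀` with `y₀` mixed** (`k ≠ 0`): `y₁ = ⋀ᵏpr₁ x`, `y₂ = ⋀ᵏpr₂ x`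
and `y₀` is the mixed part of `x` ("exterior pull-back […] always yields an injective map").
[cite: HulekLaface2019PicardNumbersAV, §2.1 Prop. 2.2 (text after the statement)] [cite: BourbakiAlgebre1a3, Ch. III §7 no. 7 Prop. 10] -/
theorem exteriorPower_prod_decomposition_unique {k : ℕ} (hk : k ≠ 0) {x : ⋀[R]^k (M × N)} {y₁ : ⋀[R]^k M} {y₂ : ⋀[R]^k N}
    {y₀ : ⋀[R]^k (M × N)} (h₁ : _root_.exteriorPower.map k (LinearMap.fst R M N) y₀ = 0)
    (h₂ : _root_.exteriorPower.map k (LinearMap.snd R M N) y₀ = 0)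
    (hx : _root_.exteriorPower.map k (LinearMap.inl R M N) y₁ + _root_.exteriorPower.map k (LinearMap.inr R M N) y₂ + y₀ = x) :
    y₁ = _root_.exteriorPower.map k (LinearMap.fst R M N) x ∧ y₂ = _root_.exteriorPower.map k (LinearMap.snd R M N) x ∧
      y₀ = x - _root_.exteriorPower.map k (LinearMap.inl R M N) (_root_.exteriorPower.map k (LinearMap.fst R M N) x) -
        _root_.exteriorPower.map k (LinearMap.inr R M N) (_root_.exteriorPower.map k (LinearMap.snd R M N) x) := by
  have e₁ : y₁ = _root_.exteriorPower.map k (LinearMap.fst R M N) x := by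
    rw [← hx, map_add, exteriorPower_map_fst_add hk, h₁, add_zero]
  have e₂ : y₂ = _root_.exteriorPower.map k (LinearMap.snd R M N) x := by
    rw [← hx, map_add, exteriorPower_map_snd_add hk, h₂, add_zero]
  refine ⟨e₁, e₂, ?_⟩
  rw [← e₁, ← e₂, ← hx]
  abel

end ModuleLevel

/-! ## §2 The Hodge classes of `⋀ᵏ(H₁ ⊕ H₂)`: pure parts and mixed part -/

section HodgeClasses

variable {V : Type u} [AddCommGroup V] [Module ℚ V] {W : Type v} [AddCommGroup W] [Module ℚ W] {n : ℤ}
  (H₁ : HodgeStructure V n) (H₂ : HodgeStructure W n)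

/-- **`⋀ᵏin₁ ⋀ᵏpr₁ x` is a Hodge class for a Hodge class `x` of `⋀ᵏ(H₁ ⊕ H₂)`** (`pr₁`, `in₁` are morphisms of Hodge structures).
[cite: VoisinHodgeI2002, §11.3.3 Thm. 11.38, Thm. 11.40] -/
theorem exteriorPower_map_inl_fst_mem_hodgeClasses {k : ℕ} {p : ℤ} {x : ⋀[ℚ]^k (V × W)}
    (hx : x ∈ ((H₁.prod H₂).exteriorPower k).hodgeClasses p) :
    _root_.exteriorPower.map k (LinearMap.inl ℚ V W) (_root_.exteriorPower.map k (LinearMap.fst ℚ V W) x) ∈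
      ((H₁.prod H₂).exteriorPower k).hodgeClasses p :=
  (Hom.prodInl H₁ H₂).exteriorPower_map_mem_hodgeClasses ((Hom.prodFst H₁ H₂).exteriorPower_map_mem_hodgeClasses hx)

/-- **`⋀ᵏin₂ ⋀ᵏpr₂ x` is a Hodge class for a Hodge class `x` of `⋀ᵏ(H₁ ⊕ H₂)`.** [cite: VoisinHodgeI2002, §11.3.3 Thm. 11.38, Thm. 11.40] -/
theorem exteriorPower_map_inr_snd_mem_hodgeClasses {k : ℕ} {p : ℤ} {x : ⋀[ℚ]^k (V × W)}
    (hx : x ∈ ((H₁.prod H₂).exteriorPower k).hodgeClasses p) :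
    _root_.exteriorPower.map k (LinearMap.inr ℚ V W) (_root_.exteriorPower.map k (LinearMap.snd ℚ V W) x) ∈
      ((H₁.prod H₂).exteriorPower k).hodgeClasses p :=
  (Hom.prodInr H₁ H₂).exteriorPower_map_mem_hodgeClasses ((Hom.prodSnd H₁ H₂).exteriorPower_map_mem_hodgeClasses hx)

/-- **The mixed part of a Hodge class is a Hodge class, killed by `⋀ᵏpr₁` and `⋀ᵏpr₂`** (`k ≠ 0`): it lies in
`Bᵏ_p(H₁ ⊕ H₂)_{mixed} = Bᵏ_p(H₁ ⊕ H₂) ⊓ ker ⋀ᵏpr₁ ⊓ ker ⋀ᵏpr₂` ("the Künneth components of a Hodge class are Hodge classes").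
[cite: VoisinHodgeI2002, §11.3.3 Thm. 11.38, Thm. 11.40] -/
theorem mixedPart_mem_hodgeClasses_inf_ker_inf_ker {k : ℕ} (hk : k ≠ 0) {p : ℤ} {x : ⋀[ℚ]^k (V × W)}
    (hx : x ∈ ((H₁.prod H₂).exteriorPower k).hodgeClasses p) :
    x - _root_.exteriorPower.map k (LinearMap.inl ℚ V W) (_root_.exteriorPower.map k (LinearMap.fst ℚ V W) x) -
        _root_.exteriorPower.map k (LinearMap.inr ℚ V W) (_root_.exteriorPower.map k (LinearMap.snd ℚ V W) x) ∈
      ((H₁.prod H₂).exteriorPower k).hodgeClasses p ⊓ LinearMap.ker (_root_.exteriorPower.map k (LinearMap.fst ℚ V W)) ⊓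
        LinearMap.ker (_root_.exteriorPower.map k (LinearMap.snd ℚ V W)) :=
  ⟨⟨sub_mem (sub_mem hx (exteriorPower_map_inl_fst_mem_hodgeClasses H₁ H₂ hx))
      (exteriorPower_map_inr_snd_mem_hodgeClasses H₁ H₂ hx),
    exteriorPower_map_fst_mixedPart hk x⟩, exteriorPower_map_snd_mixedPart hk x⟩

/-- **`Bᵏ_p(H₁ ⊕ H₂) = ⋀ᵏin₁ Bᵏ_p(H₁) ⊔ ⋀ᵏin₂ Bᵏ_p(H₂) ⊔ Bᵏ_p(H₁ ⊕ H₂)_{mixed}`** (`k ≠ 0`, any weight, any level `p`): every Hodge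
class of `⋀ᵏ(H₁ ⊕ H₂)` is the sum of the exterior pull-backs of the Hodge classes `⋀ᵏpr₁ x`, `⋀ᵏpr₂ x` of the factors and of its
mixed part. [cite: HulekLaface2019PicardNumbersAV, §2.1 Prop. 2.2] [cite: VoisinHodgeI2002, §11.3.3 Thm. 11.38, Thm. 11.40] -/
theorem hodgeClasses_exteriorPower_prod_eq_sup {k : ℕ} (hk : k ≠ 0) (p : ℤ) :
    ((H₁.prod H₂).exteriorPower k).hodgeClasses p =
      ((H₁.exteriorPower k).hodgeClasses p).map (_root_.exteriorPower.map k (LinearMap.inl ℚ V W)) ⊔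
        ((H₂.exteriorPower k).hodgeClasses p).map (_root_.exteriorPower.map k (LinearMap.inr ℚ V W)) ⊔
          (((H₁.prod H₂).exteriorPower k).hodgeClasses p ⊓ LinearMap.ker (_root_.exteriorPower.map k (LinearMap.fst ℚ V W)) ⊓
            LinearMap.ker (_root_.exteriorPower.map k (LinearMap.snd ℚ V W))) := by
  refine le_antisymm (fun x hx ↦ ?_) (sup_le (sup_le ?_ ?_) fun x hx ↦ hx.1.1)
  · have hdec : x = _root_.exteriorPower.map k (LinearMap.inl ℚ V W) (_root_.exteriorPower.map k (LinearMap.fst ℚ V W) x) +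
        _root_.exteriorPower.map k (LinearMap.inr ℚ V W) (_root_.exteriorPower.map k (LinearMap.snd ℚ V W) x) +
        (x - _root_.exteriorPower.map k (LinearMap.inl ℚ V W) (_root_.exteriorPower.map k (LinearMap.fst ℚ V W) x) -
          _root_.exteriorPower.map k (LinearMap.inr ℚ V W) (_root_.exteriorPower.map k (LinearMap.snd ℚ V W) x)) := by
      abel
    rw [hdec]
    exact Submodule.add_mem _ (Submodule.add_mem _
      (Submodule.mem_sup_left (Submodule.mem_sup_left
        ⟨_, (Hom.prodFst H₁ H₂).exteriorPower_map_mem_hodgeClasses hx, rfl⟩))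
      (Submodule.mem_sup_left (Submodule.mem_sup_right
        ⟨_, (Hom.prodSnd H₁ H₂).exteriorPower_map_mem_hodgeClasses hx, rfl⟩)))
      (Submodule.mem_sup_right (mixedPart_mem_hodgeClasses_inf_ker_inf_ker H₁ H₂ hk hx))
  · exact (Hom.prodInl H₁ H₂).map_exteriorPower_hodgeClasses_le k p
  · exact (Hom.prodInr H₁ H₂).map_exteriorPower_hodgeClasses_le k p

/-- **The exterior pull-backs `⋀ᵏin₁ Bᵏ_p(H₁)` and `⋀ᵏin₂ Bᵏ_p(H₂)` meet trivially** (`k ≠ 0`; apply `⋀ᵏpr₁`).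
[cite: HulekLaface2019PicardNumbersAV, §2.1 Prop. 2.2 ("always yields an injective map")] -/
theorem disjoint_map_inl_map_inr_hodgeClasses {k : ℕ} (hk : k ≠ 0) (p : ℤ) :
    Disjoint (((H₁.exteriorPower k).hodgeClasses p).map (_root_.exteriorPower.map k (LinearMap.inl ℚ V W)))
      (((H₂.exteriorPower k).hodgeClasses p).map (_root_.exteriorPower.map k (LinearMap.inr ℚ V W))) := by
  rw [Submodule.disjoint_def]
  rintro _ ⟨y₁, -, rfl⟩ ⟨y₂, -, h⟩
  have h1 := congrArg (_root_.exteriorPower.map k (LinearMap.fst ℚ V W)) h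
  rw [← LinearMap.comp_apply, exteriorPower_map_fst_comp_map_inr hk, LinearMap.zero_apply, ← LinearMap.comp_apply,
    exteriorPower_map_fst_comp_map_inl, LinearMap.id_apply] at h1
  rw [← h1, map_zero]

/-- **The pure part `⋀ᵏin₁ Bᵏ_p(H₁) ⊔ ⋀ᵏin₂ Bᵏ_p(H₂)` meets the mixed part trivially** (`k ≠ 0`).
[cite: HulekLaface2019PicardNumbersAV, §2.1 Prop. 2.2] [cite: BourbakiAlgebre1a3, Ch. III §7 no. 7 Prop. 10] -/
theorem disjoint_sup_map_hodgeClasses_mixed {k : ℕ} (hk : k ≠ 0) (p : ℤ) :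
    Disjoint (((H₁.exteriorPower k).hodgeClasses p).map (_root_.exteriorPower.map k (LinearMap.inl ℚ V W)) ⊔
        ((H₂.exteriorPower k).hodgeClasses p).map (_root_.exteriorPower.map k (LinearMap.inr ℚ V W)))
      (((H₁.prod H₂).exteriorPower k).hodgeClasses p ⊓ LinearMap.ker (_root_.exteriorPower.map k (LinearMap.fst ℚ V W)) ⊓
        LinearMap.ker (_root_.exteriorPower.map k (LinearMap.snd ℚ V W))) := by
  rw [Submodule.disjoint_def]
  intro x hx hx₀
  obtain ⟨_, ⟨y₁, -, rfl⟩, _, ⟨y₂, -, rfl⟩, rfl⟩ := Submodule.mem_sup.1 hx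
  have e := exteriorPower_prod_decomposition_unique hk (LinearMap.mem_ker.1 hx₀.1.2) (LinearMap.mem_ker.1 hx₀.2)
    (x := _root_.exteriorPower.map k (LinearMap.inl ℚ V W) y₁ + _root_.exteriorPower.map k (LinearMap.inr ℚ V W) y₂)
    (y₁ := 0) (y₂ := 0) (by rw [map_zero, map_zero, zero_add, zero_add])
  rw [exteriorPower_map_fst_add hk, exteriorPower_map_snd_add hk] at e
  rw [← e.1, ← e.2.1, map_zero, map_zero, add_zero]

/-- **`dim Bᵏ_p(H₁ ⊕ H₂) = dim Bᵏ_p(H₁) + dim Bᵏ_p(H₂) + dim Bᵏ_p(H₁ ⊕ H₂)_{mixed}`** (`k ≠ 0`, any weight, finite-dimensional `V`, `W`):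
the decomposition `Bᵏ_p(H₁ ⊕ H₂) = ⋀ᵏin₁ Bᵏ_p(H₁) ⊔ ⋀ᵏin₂ Bᵏ_p(H₂) ⊔ (mixed)` is direct (the two `Disjoint` statements above) and
`⋀ᵏin₁`, `⋀ᵏin₂` are injective. [cite: HulekLaface2019PicardNumbersAV, §2.1 Prop. 2.2, Cor. 2.3]
[cite: VoisinHodgeI2002, §11.3.3 Thm. 11.38, Thm. 11.40] -/
theorem finrank_hodgeClasses_exteriorPower_prod_eq [Module.Finite ℚ V] [Module.Finite ℚ W] {k : ℕ} (hk : k ≠ 0) (p : ℤ) :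
    Module.finrank ℚ (((H₁.prod H₂).exteriorPower k).hodgeClasses p) =
      Module.finrank ℚ ((H₁.exteriorPower k).hodgeClasses p) + Module.finrank ℚ ((H₂.exteriorPower k).hodgeClasses p) +
        Module.finrank ℚ ↥(((H₁.prod H₂).exteriorPower k).hodgeClasses p ⊓
          LinearMap.ker (_root_.exteriorPower.map k (LinearMap.fst ℚ V W)) ⊓
            LinearMap.ker (_root_.exteriorPower.map k (LinearMap.snd ℚ V W))) := by
  have e₁ := (Submodule.equivMapOfInjective _
    (_root_.exteriorPower.map_injective_field (n := k) (LinearMap.inl_injective (R := ℚ) (M := V) (M₂ := W)))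
    ((H₁.exteriorPower k).hodgeClasses p)).finrank_eq
  have e₂ := (Submodule.equivMapOfInjective _
    (_root_.exteriorPower.map_injective_field (n := k) (LinearMap.inr_injective (R := ℚ) (M := V) (M₂ := W)))
    ((H₂.exteriorPower k).hodgeClasses p)).finrank_eq
  have h12 := Submodule.finrank_sup_add_finrank_inf_eq
    (((H₁.exteriorPower k).hodgeClasses p).map (_root_.exteriorPower.map k (LinearMap.inl ℚ V W)))
    (((H₂.exteriorPower k).hodgeClasses p).map (_root_.exteriorPower.map k (LinearMap.inr ℚ V W)))
  rw [(disjoint_map_inl_map_inr_hodgeClasses H₁ H₂ hk p).eq_bot, finrank_bot, add_zero] at h12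
  have h := Submodule.finrank_sup_add_finrank_inf_eq
    (((H₁.exteriorPower k).hodgeClasses p).map (_root_.exteriorPower.map k (LinearMap.inl ℚ V W)) ⊔
      ((H₂.exteriorPower k).hodgeClasses p).map (_root_.exteriorPower.map k (LinearMap.inr ℚ V W)))
    (((H₁.prod H₂).exteriorPower k).hodgeClasses p ⊓ LinearMap.ker (_root_.exteriorPower.map k (LinearMap.fst ℚ V W)) ⊓
      LinearMap.ker (_root_.exteriorPower.map k (LinearMap.snd ℚ V W)))
  rw [(disjoint_sup_map_hodgeClasses_mixed H₁ H₂ hk p).eq_bot, finrank_bot, add_zero,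
    ← hodgeClasses_exteriorPower_prod_eq_sup H₁ H₂ hk p, h12] at h
  rw [h, e₁, e₂]

/-- **`dim Bᵏ_p(H₁ ⊕ H₂)_{mixed} = dim Bᵏ_p(H₁ ⊕ H₂) − dim Bᵏ_p(H₁) − dim Bᵏ_p(H₂)`** (`k ≠ 0`).
[cite: HulekLaface2019PicardNumbersAV, §2.1 Prop. 2.2, Cor. 2.3] -/
theorem finrank_hodgeClasses_exteriorPower_prod_mixed_eq [Module.Finite ℚ V] [Module.Finite ℚ W] {k : ℕ} (hk : k ≠ 0) (p : ℤ) :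
    Module.finrank ℚ ↥(((H₁.prod H₂).exteriorPower k).hodgeClasses p ⊓
        LinearMap.ker (_root_.exteriorPower.map k (LinearMap.fst ℚ V W)) ⊓
          LinearMap.ker (_root_.exteriorPower.map k (LinearMap.snd ℚ V W))) =
      Module.finrank ℚ (((H₁.prod H₂).exteriorPower k).hodgeClasses p) -
        Module.finrank ℚ ((H₁.exteriorPower k).hodgeClasses p) - Module.finrank ℚ ((H₂.exteriorPower k).hodgeClasses p) := by
  rw [finrank_hodgeClasses_exteriorPower_prod_eq H₁ H₂ hk p]
  omega

/-- **No mixed Hodge classes ⟺ `Bᵏ_p(H₁ ⊕ H₂) = ⋀ᵏin₁ Bᵏ_p(H₁) ⊔ ⋀ᵏin₂ Bᵏ_p(H₂)`** — the exterior pull-back is onto the Hodge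
classes iff the mixed part vanishes (`k ≠ 0`). [cite: HulekLaface2019PicardNumbersAV, §2.1 Prop. 2.2] -/
theorem hodgeClasses_exteriorPower_prod_eq_sup_map_iff {k : ℕ} (hk : k ≠ 0) (p : ℤ) :
    ((H₁.prod H₂).exteriorPower k).hodgeClasses p =
        ((H₁.exteriorPower k).hodgeClasses p).map (_root_.exteriorPower.map k (LinearMap.inl ℚ V W)) ⊔
          ((H₂.exteriorPower k).hodgeClasses p).map (_root_.exteriorPower.map k (LinearMap.inr ℚ V W)) ↔
      ((H₁.prod H₂).exteriorPower k).hodgeClasses p ⊓ LinearMap.ker (_root_.exteriorPower.map k (LinearMap.fst ℚ V W)) ⊓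
          LinearMap.ker (_root_.exteriorPower.map k (LinearMap.snd ℚ V W)) = ⊥ := by
  constructor
  · intro h
    exact (disjoint_sup_map_hodgeClasses_mixed H₁ H₂ hk p).symm.eq_bot_of_le fun x hx ↦ h ▸ hx.1.1
  · intro h
    conv_lhs => rw [hodgeClasses_exteriorPower_prod_eq_sup H₁ H₂ hk p, h, sup_bot_eq]

end HodgeClasses

/-! ## §3 Degree two, odd weight: the mixed divisor classes and `Hom_HS(H₁, H₂)` -/

section DegreeTwo

variable {V : Type u} [AddCommGroup V] [Module ℚ V] [Module.Finite ℚ V] {W : Type u} [AddCommGroup W] [Module ℚ W]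
  [Module.Finite ℚ W] {n : ℤ} {H₁ : HodgeStructure V n} {H₂ : HodgeStructure W n} (Q₁ : Polarization H₁) (Q₂ : Polarization H₂)

include Q₁ Q₂ in
/-- **`dim B¹(H₁ ⊕ H₂)_{mixed} = dim_ℚ Hom_HS(H₁, H₂)`** for polarized `ℚ`-Hodge structures of the same odd weight — the carrier
form of "`NS(A₁ × A₂) ⊗ ℚ = p₁^*NS(A₁)_ℚ ⊕ p₂^*NS(A₂)_ℚ ⊕ Hom(A₁, A₂)_ℚ`": by §2 `ρ(H₁ ⊕ H₂) = ρ(H₁) + ρ(H₂) + dim B¹_{mixed}` and by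
g26-#5 `ρ(H₁ ⊕ H₂) = ρ(H₁) + ρ(H₂) + dim Hom_HS(H₁, H₂)`. [cite: Lange2023AbelianVarietiesComplex, §2.4.2 Prop. 2.4.12 (a) (chunk p0118)]
[cite: HulekLaface2019PicardNumbersAV, §2.1 Prop. 2.2, Cor. 2.3] -/
theorem Polarization.finrank_hodgeClasses_two_prod_mixed_eq (hn : Odd n) :
    Module.finrank ℚ ↥(((H₁.prod H₂).exteriorPower 2).hodgeClasses n ⊓
        LinearMap.ker (_root_.exteriorPower.map 2 (LinearMap.fst ℚ V W)) ⊓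
          LinearMap.ker (_root_.exteriorPower.map 2 (LinearMap.snd ℚ V W))) =
      Module.finrank ℚ (Hom H₁ H₂) := by
  have h := finrank_hodgeClasses_exteriorPower_prod_eq H₁ H₂ two_ne_zero n
  rw [Q₁.finrank_hodgeClasses_two_prod Q₂ hn] at h
  omega

include Q₁ Q₂ in
/-- **`Hom_HS(H₁, H₂) = 0 ⟹` there are no mixed divisor classes** (odd weight, polarized: "`Hom(A_i, A_j) = 0` […] `ψ^{NS}` is an
isomorphism"). [cite: HulekLaface2019PicardNumbersAV, §2.1 Prop. 2.2 (proof)] -/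
theorem Polarization.hodgeClasses_two_prod_mixed_eq_bot_of_subsingleton_hom (hn : Odd n) [Subsingleton (Hom H₁ H₂)] :
    ((H₁.prod H₂).exteriorPower 2).hodgeClasses n ⊓ LinearMap.ker (_root_.exteriorPower.map 2 (LinearMap.fst ℚ V W)) ⊓
        LinearMap.ker (_root_.exteriorPower.map 2 (LinearMap.snd ℚ V W)) = ⊥ := by
  rw [← Submodule.finrank_eq_zero, Q₁.finrank_hodgeClasses_two_prod_mixed_eq Q₂ hn]
  exact Module.finrank_zero_of_subsingleton

include Q₁ Q₂ in
/-- **Hulek–Laface Prop. 2.2 on the carrier: for `Hom_HS(H₁, H₂) = 0` the exterior pull-back is onto the divisor classes,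
`B¹(H₁ ⊕ H₂) = ⋀²in₁ B¹(H₁) ⊔ ⋀²in₂ B¹(H₂)`** (odd weight, polarized; the sum is direct by §2).
[cite: HulekLaface2019PicardNumbersAV, §2.1 Prop. 2.2] -/
theorem Polarization.hodgeClasses_two_prod_eq_sup_map_of_subsingleton_hom (hn : Odd n) [Subsingleton (Hom H₁ H₂)] :
    ((H₁.prod H₂).exteriorPower 2).hodgeClasses n =
      ((H₁.exteriorPower 2).hodgeClasses n).map (_root_.exteriorPower.map 2 (LinearMap.inl ℚ V W)) ⊔
        ((H₂.exteriorPower 2).hodgeClasses n).map (_root_.exteriorPower.map 2 (LinearMap.inr ℚ V W)) :=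
  (hodgeClasses_exteriorPower_prod_eq_sup_map_iff H₁ H₂ two_ne_zero n).2
    (Q₁.hodgeClasses_two_prod_mixed_eq_bot_of_subsingleton_hom Q₂ hn)

include Q₁ Q₂ in
/-- **A non-zero morphism `H₁ → H₂` produces a mixed divisor class** (odd weight, polarized): if `Hom_HS(H₁, H₂) ≠ 0` then
`B¹(H₁ ⊕ H₂)_{mixed} ≠ 0` and the exterior pull-back is NOT onto ("surjectivity is a special feature […] `E × E` has Picard number
`ρ ∈ {3, 4}` […] cannot be surjective"). [cite: HulekLaface2019PicardNumbersAV, §2.1 Prop. 2.2 (text after the statement)] -/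
theorem Polarization.hodgeClasses_two_prod_mixed_ne_bot_of_nontrivial_hom (hn : Odd n) [Nontrivial (Hom H₁ H₂)] :
    ((H₁.prod H₂).exteriorPower 2).hodgeClasses n ⊓ LinearMap.ker (_root_.exteriorPower.map 2 (LinearMap.fst ℚ V W)) ⊓
        LinearMap.ker (_root_.exteriorPower.map 2 (LinearMap.snd ℚ V W)) ≠ ⊥ := by
  haveI : Module.Finite ℚ (Hom H₁ H₂) :=
    Module.Finite.of_injective ({ toFun := Hom.toLinearMap, map_add' := fun _ _ ↦ rfl, map_smul' := fun _ _ ↦ rfl } :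
      Hom H₁ H₂ →ₗ[ℚ] (V →ₗ[ℚ] W)) Hom.toLinearMap_injective
  rw [Ne, ← Submodule.finrank_eq_zero, Q₁.finrank_hodgeClasses_two_prod_mixed_eq Q₂ hn]
  exact Module.finrank_pos.ne'

include Q₁ Q₂ in
/-- **The exterior pull-back is onto the divisor classes of `H₁ ⊕ H₂` iff `Hom_HS(H₁, H₂) = 0`** (odd weight, polarized).
[cite: HulekLaface2019PicardNumbersAV, §2.1 Prop. 2.2] -/
theorem Polarization.hodgeClasses_two_prod_eq_sup_map_iff_subsingleton_hom (hn : Odd n) :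
    ((H₁.prod H₂).exteriorPower 2).hodgeClasses n =
        ((H₁.exteriorPower 2).hodgeClasses n).map (_root_.exteriorPower.map 2 (LinearMap.inl ℚ V W)) ⊔
          ((H₂.exteriorPower 2).hodgeClasses n).map (_root_.exteriorPower.map 2 (LinearMap.inr ℚ V W)) ↔
      Subsingleton (Hom H₁ H₂) := by
  refine ⟨fun h ↦ ?_, fun _ ↦ Q₁.hodgeClasses_two_prod_eq_sup_map_of_subsingleton_hom Q₂ hn⟩
  by_contra hne
  rw [not_subsingleton_iff_nontrivial] at hne
  exact Q₁.hodgeClasses_two_prod_mixed_ne_bot_of_nontrivial_hom Q₂ hn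
    ((hodgeClasses_exteriorPower_prod_eq_sup_map_iff H₁ H₂ two_ne_zero n).1 h)

/-- **The same for `H ⊕ H`: the mixed divisor classes of `H ⊕ H` have dimension `dim_ℚ E_φ(H) ≥ 1`** (odd weight, polarized) —
"the exterior pull-back map `Pic(E) × Pic(E) → Pic(E × E)` cannot be surjective".
[cite: HulekLaface2019PicardNumbersAV, §2.1 Prop. 2.2 (the example E × E)] -/
theorem Polarization.finrank_hodgeClasses_two_prod_self_mixed_eq {H : HodgeStructure V n} (Q : Polarization H) (hn : Odd n) :
    Module.finrank ℚ ↥(((H.prod H).exteriorPower 2).hodgeClasses n ⊓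
        LinearMap.ker (_root_.exteriorPower.map 2 (LinearMap.fst ℚ V V)) ⊓
          LinearMap.ker (_root_.exteriorPower.map 2 (LinearMap.snd ℚ V V))) =
      Module.finrank ℚ H.endAlg := by
  rw [Q.finrank_hodgeClasses_two_prod_mixed_eq Q hn, finrank_endAlg_eq_finrank_hom H]

end DegreeTwo

end HodgeStructure

end Literature.AlgebraicGeometry.Motives

end
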